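import Summits.QuantumFields.YangMills.Theorems.SmallFieldWideningWideningOfTiltAndMassTVLaw

/-!
# Route `SmallFieldWidening` — THE TOTAL-VARIATION WIDENING FOR SUMMABLE RATES: K1 ∧ K2 (`UnitTiltTail`) ⇒ uniformly Cauchy
# unit laws ⇒ an `L¹(product Haar)` limit density (support of item `WideningOfTiltAndMass`, stmt-QuantumFields-22885; helper,
# route-independent; serves equally the sister route `UnitScaleTilt`'s K1 ∧ K2 packages)

WHAT THIS IS NOT: not K1, not K2, not E3 — every statement is keyed on the tree's hypothesis schema `UnitTiltTail F ℰ γ r w w'`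
(resp. the K1/K2 bodies `UnitTiltAt`, `HistoryTailAt`), never asserted; not d = 4, not a mass gap, not Clay; no summit is proved.

WHAT IT IS.  The tree's Cauchy device `T3UnitScaleTilt.exists_tendsto_integral_unitLaw` ([King1986] (3.13)) concludes, for K1 ∧ K2
at the unit lattice with SUMMABLE rates, that `∫ W d(unitLaw K)` converges for EACH measurable `|W| ≤ 1`.  Its increment bound
`abs_integral_unitLaw_succ_sub_le` (`8r_K + 4w_K + 2w'_K`) is `W`-free, so the convergence is UNIFORM over `|W| ≤ 1`:
* §1 (every `G`, every measurable `ℰ`, `γ ≥ 0`): `UnitTiltTail` with summable `r, w, w'` ⇒ the unit laws are UNIFORMLY CAUCHY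
  over measurable `|W| ≤ 1` (`unitLaw_uniformCauchy_of_unitTiltTail`); the same for the ORIGINAL family from the schema at the
  REFINED family `F.refine n` (`unitLaw_uniformCauchy_of_refine_unitTiltTail`, transport by `unitLaw_add_eq_map_coarsen`).
* §2 (`SU(2)`, printed smearing `ℰp`, `γ ≥ 0`): uniformly Cauchy unit laws ⇒ the normalised renormalised densities `Z_J⁻¹ρ̂_J`
  converge in `L¹(dV_{T₁})` to a probability density `ρ_∞ ≥ 0` and the unit laws converge to `ρ_∞ dV_{T₁}` in TOTAL VARIATION
  (`exists_limitUnitDensity_of_uniformCauchy`, `exists_limitUnitLaw_TV_of_uniformCauchy` — the sibling file's §1 made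
  hypothesis-generic); instances: the K1 ∧ K2 bodies with ANY free top fraction `1/m` at any refinement depth
  (`exists_limitUnitDensity_of_unitTiltAt_historyTailAt`, route `UnitScaleTilt`'s quantifier shape) and the all-heights /
  uniform-mass hypotheses of this route's item (the sibling file `…TVLaw`).
-/

noncomputable section

open MeasureTheory Filter Topology
open scoped ENNReal
open Literature.MathematicalPhysics.QuantumFieldTheory.Balaban1983to89
open Literature.MathematicalPhysics.QuantumFieldTheory.Balaban1983to89.Missing
open Literature.MathematicalPhysics.QuantumFieldTheory.Balaban1983to89.T3ContinuumYM3Torus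
open Literature.MathematicalPhysics.QuantumFieldTheory.Balaban1983to89.T3ThresholdRemoval
open Literature.MathematicalPhysics.QuantumFieldTheory.Balaban1983to89.T3UnitLawDensityEML
open Literature.MathematicalPhysics.QuantumFieldTheory.Balaban1983to89.T3UnitScaleTilt
open Literature.MathematicalPhysics.QuantumFieldTheory.Balaban1983to89.T3ContinuumUnitLaw
open Summit.QuantumFields.YangMills.Theorems.WideningTVLaw

namespace Summit.QuantumFields.YangMills.Theorems.WideningTVTail

/-! ## §1 Summable rates: uniformly Cauchy unit laws (every `G`, every measurable `ℰ`) -/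

section Generic

variable (F : T3Family) {G : Type*} [GaugeGroup G] [MeasurableSpace G] [HaarData G] [RegularGaugeGroup G]
  (ℰ : LoopAverage G) (hE : ℰ.MeasurableE)

/-- **K1 ∧ K2 WITH SUMMABLE RATES ⇒ UNIFORMLY CAUCHY UNIT LAWS** (every `G`, measurable `ℰ`, `γ ≥ 0`): under
`UnitTiltTail F ℰ γ r w w'` with `Σ r, Σ w, Σ w' < ∞`, for every `ε > 0` ONE index `K₁` gives
`|∫ W d(unitLaw K) − ∫ W d(unitLaw K')| ≤ ε` for all `K, K' ≥ K₁` and ALL measurable `|W| ≤ 1` (telescoping the `W`-free increment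
bound `abs_integral_unitLaw_succ_sub_le`; [King1986] (3.13) read in total variation). -/
theorem unitLaw_uniformCauchy_of_unitTiltTail {γ : ℝ} (hγ : 0 ≤ γ) {r w w' : ℕ → ℝ} (hr : Summable r)
    (hw : Summable w) (hw' : Summable w') (h : UnitTiltTail F ℰ γ r w w') {ε : ℝ} (hε : 0 < ε) :
    ∃ K₁ : ℕ, ∀ K K' : ℕ, K₁ ≤ K → K₁ ≤ K' → ∀ W : GaugeField (F.P 0) 0 G → ℝ, Measurable W → (∀ u, |W u| ≤ 1) →
      |(∫ u, W u ∂F.unitLaw ℰ hE γ K) - ∫ u, W u ∂F.unitLaw ℰ hE γ K'| ≤ ε := by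
  have hd : Summable fun K => 8 * r K + 4 * w K + 2 * w' K :=
    ((hr.mul_left 8).add (hw.mul_left 4)).add (hw'.mul_left 2)
  have hS : CauchySeq fun N => ∑ i ∈ Finset.range N, (8 * r i + 4 * w i + 2 * w' i) :=
    hd.hasSum.tendsto_sum_nat.cauchySeq
  obtain ⟨K₁, hK₁⟩ := Metric.cauchySeq_iff.mp hS ε hε
  refine ⟨K₁, fun K K' hK hK' W hWm hW => ?_⟩
  wlog hKK' : K ≤ K' generalizing K K'
  · rw [abs_sub_comm]; exact this K' K hK' hK (le_of_not_ge hKK')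
  have h1 := dist_le_Ico_sum_of_dist_le (f := fun k => ∫ u, W u ∂F.unitLaw ℰ hE γ k) hKK'
    (d := fun i => 8 * r i + 4 * w i + 2 * w' i)
    (fun {k} _ _ => by rw [Real.dist_eq, abs_sub_comm]; exact abs_integral_unitLaw_succ_sub_le hE hγ h hWm hW k)
  have h2 : ∑ i ∈ Finset.Ico K K', (8 * r i + 4 * w i + 2 * w' i) < ε := by
    have h := hK₁ K' hK' K hK
    rw [Real.dist_eq, ← Finset.sum_Ico_eq_sub _ hKK'] at h
    exact (le_abs_self _).trans_lt h
  rw [Real.dist_eq] at h1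
  linarith

/-- **THE SAME FOR THE ORIGINAL FAMILY FROM THE REFINED ONE** (threshold removal at the level of laws, every `G`, measurable
`ℰ`, `γ ≥ 0`): `UnitTiltTail (F.refine n) ℰ (γL^{-n}) r w w'` with summable rates ⇒ the unit laws `unitLaw F ℰ γ J` are uniformly
Cauchy over measurable `|g| ≤ 1` (`unitLaw^{F}_{K+n} = (Π_n)_* unitLaw^{F.refine n}_K`, `g ∘ Π_n` measurable and bounded by `1`). -/
theorem unitLaw_uniformCauchy_of_refine_unitTiltTail (n : ℕ) {γ : ℝ} (hγ : 0 ≤ γ) {r w w' : ℕ → ℝ}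
    (hr : Summable r) (hw : Summable w) (hw' : Summable w')
    (h : UnitTiltTail (F.refine n) ℰ (γ * ((F.L : ℝ)⁻¹) ^ n) r w w') {ε : ℝ} (hε : 0 < ε) :
    ∃ J₀ : ℕ, ∀ J J' : ℕ, J₀ ≤ J → J₀ ≤ J' → ∀ g : GaugeField (F.P 0) 0 G → ℝ, Measurable g → (∀ u, |g u| ≤ 1) →
      |(∫ u, g u ∂F.unitLaw ℰ hE γ J) - ∫ u, g u ∂F.unitLaw ℰ hE γ J'| ≤ ε := by
  have hγ' : 0 ≤ γ * ((F.L : ℝ)⁻¹) ^ n := mul_nonneg hγ (pow_nonneg (inv_nonneg.mpr (Nat.cast_nonneg _)) n)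
  obtain ⟨K₁, hK₁⟩ := unitLaw_uniformCauchy_of_unitTiltTail (F.refine n) ℰ hE hγ' hr hw hw' h hε
  refine ⟨K₁ + n, fun J J' hJ hJ' g hgm hg1 => ?_⟩
  obtain ⟨K, rfl⟩ := Nat.exists_eq_add_of_le' ((Nat.le_add_left n K₁).trans hJ)
  obtain ⟨K', rfl⟩ := Nat.exists_eq_add_of_le' ((Nat.le_add_left n K₁).trans hJ')
  have hmc := measurable_coarsen F n ℰ hE (G := G)
  rw [unitLaw_add_eq_map_coarsen F n ℰ hE hγ K, unitLaw_add_eq_map_coarsen F n ℰ hE hγ K',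
    integral_map hmc.aemeasurable hgm.aestronglyMeasurable,
    integral_map hmc.aemeasurable hgm.aestronglyMeasurable]
  exact hK₁ K K' (Nat.le_of_add_le_add_right hJ) (Nat.le_of_add_le_add_right hJ')
    (fun u => g (coarsen F n ℰ u)) (hgm.comp hmc) (fun u => hg1 _)

end Generic

/-! ## §2 `SU(2)`, printed smearing: uniformly Cauchy unit laws ⇒ `L¹(dV_{T₁})` limit density, total-variation limit law -/

section UnitLaw

variable (F : T3Family)

/-- **UNIFORMLY CAUCHY UNIT LAWS ⇒ `L¹`-CAUCHY DENSITIES** (`SU(2)`, `ℰp`, `γ ≥ 0`; `unitLaw J = Z_J⁻¹ρ̂_J dV_{T₁}` hypothesis-free by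
`unitLaw_eq_withDensity_emlDensity`, sign observable `WideningTVLaw.integral_abs_sub_le_of_withDensity`). -/
theorem unitDensity_L1_cauchy_of_uniformCauchy {γ : ℝ} (hγ : 0 ≤ γ)
    (hC : ∀ ε : ℝ, 0 < ε → ∃ J₀ : ℕ, ∀ J J' : ℕ, J₀ ≤ J → J₀ ≤ J' →
      ∀ g : GaugeField (F.P 0) 0 (Matrix.specialUnitaryGroup (Fin 2) ℂ) → ℝ, Measurable g → (∀ u, |g u| ≤ 1) →
        |(∫ u, g u ∂F.unitLaw ℰp measurableE_ℰp γ J) - ∫ u, g u ∂F.unitLaw ℰp measurableE_ℰp γ J'| ≤ ε)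
    {ε : ℝ} (hε : 0 < ε) :
    ∃ J₀ : ℕ, ∀ J J' : ℕ, J₀ ≤ J → J₀ ≤ J' →
      ∫ u, |(partitionFn (G := Matrix.specialUnitaryGroup (Fin 2) ℂ) (F.P J) ((F.scheme ℰp γ).β J))⁻¹ *
            unitDensity F γ J u -
          (partitionFn (G := Matrix.specialUnitaryGroup (Fin 2) ℂ) (F.P J') ((F.scheme ℰp γ).β J'))⁻¹ *
            unitDensity F γ J' u| ∂fieldMeasure (F.P 0) 0 (Matrix.specialUnitaryGroup (Fin 2) ℂ) ≤ ε := by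
  obtain ⟨J₀, hJ₀⟩ := hC ε hε
  refine ⟨J₀, fun J J' hJ hJ' => ?_⟩
  obtain ⟨hdm, hd0, hdi⟩ := unitDensity_props F J hγ
  obtain ⟨hdm', hd0', hdi'⟩ := unitDensity_props F J' hγ
  have hZ : 0 < partitionFn (G := Matrix.specialUnitaryGroup (Fin 2) ℂ) (F.P J) ((F.scheme ℰp γ).β J) :=
    partitionFn_pos' _ (F.scheme_β_nonneg ℰp hγ J)
  have hZ' : 0 < partitionFn (G := Matrix.specialUnitaryGroup (Fin 2) ℂ) (F.P J') ((F.scheme ℰp γ).β J') :=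
    partitionFn_pos' _ (F.scheme_β_nonneg ℰp hγ J')
  refine integral_abs_sub_le_of_withDensity _ (hdm.const_mul _) (hdm'.const_mul _)
    (fun u => mul_nonneg (inv_nonneg.mpr hZ.le) (hd0 u)) (fun u => mul_nonneg (inv_nonneg.mpr hZ'.le) (hd0' u))
    (hdi.const_mul _) (hdi'.const_mul _) fun g hgm hg1 => ?_
  rw [← unitLaw_eq_withDensity_emlDensity F J hγ, ← unitLaw_eq_withDensity_emlDensity F J' hγ]
  exact hJ₀ J J' hJ hJ' g hgm hg1

/-- **UNIFORMLY CAUCHY UNIT LAWS ⇒ THE EFFECTIVE DENSITIES CONVERGE IN `L¹(dV_{T₁})`** (`SU(2)`, `ℰp`, `γ ≥ 0`): a measurable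
probability density `ρ_∞ ≥ 0` with `∫ |Z_J⁻¹ρ̂_J − ρ_∞| dV_{T₁} → 0`. -/
theorem exists_limitUnitDensity_of_uniformCauchy {γ : ℝ} (hγ : 0 ≤ γ)
    (hC : ∀ ε : ℝ, 0 < ε → ∃ J₀ : ℕ, ∀ J J' : ℕ, J₀ ≤ J → J₀ ≤ J' →
      ∀ g : GaugeField (F.P 0) 0 (Matrix.specialUnitaryGroup (Fin 2) ℂ) → ℝ, Measurable g → (∀ u, |g u| ≤ 1) →
        |(∫ u, g u ∂F.unitLaw ℰp measurableE_ℰp γ J) - ∫ u, g u ∂F.unitLaw ℰp measurableE_ℰp γ J'| ≤ ε) :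
    ∃ ρl : GaugeField (F.P 0) 0 (Matrix.specialUnitaryGroup (Fin 2) ℂ) → ℝ, Measurable ρl ∧ (∀ u, 0 ≤ ρl u) ∧
      Integrable ρl (fieldMeasure (F.P 0) 0 (Matrix.specialUnitaryGroup (Fin 2) ℂ)) ∧
      ∫ u, ρl u ∂fieldMeasure (F.P 0) 0 (Matrix.specialUnitaryGroup (Fin 2) ℂ) = 1 ∧
      Tendsto (fun J => ∫ u, |(partitionFn (G := Matrix.specialUnitaryGroup (Fin 2) ℂ) (F.P J)
          ((F.scheme ℰp γ).β J))⁻¹ * unitDensity F γ J u - ρl u|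
        ∂fieldMeasure (F.P 0) 0 (Matrix.specialUnitaryGroup (Fin 2) ℂ)) atTop (𝓝 0) := by
  have hZ : ∀ J, 0 < partitionFn (G := Matrix.specialUnitaryGroup (Fin 2) ℂ) (F.P J) ((F.scheme ℰp γ).β J) := fun J =>
    partitionFn_pos' _ (F.scheme_β_nonneg ℰp hγ J)
  have h0 : ∀ J u, 0 ≤ (partitionFn (G := Matrix.specialUnitaryGroup (Fin 2) ℂ) (F.P J) ((F.scheme ℰp γ).β J))⁻¹ *
      unitDensity F γ J u := fun J u => mul_nonneg (inv_nonneg.mpr (hZ J).le) ((unitDensity_props F J hγ).2.1 u)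
  have hi : ∀ J, Integrable (fun u => (partitionFn (G := Matrix.specialUnitaryGroup (Fin 2) ℂ) (F.P J)
      ((F.scheme ℰp γ).β J))⁻¹ * unitDensity F γ J u) (fieldMeasure (F.P 0) 0 (Matrix.specialUnitaryGroup (Fin 2) ℂ)) :=
    fun J => (unitDensity_props F J hγ).2.2.const_mul _
  obtain ⟨ρl, hm, hl0, hil, hlim⟩ := exists_limit_density (fieldMeasure (F.P 0) 0 (Matrix.specialUnitaryGroup (Fin 2) ℂ))
    (fun J u => (partitionFn (G := Matrix.specialUnitaryGroup (Fin 2) ℂ) (F.P J) ((F.scheme ℰp γ).β J))⁻¹ *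
      unitDensity F γ J u) h0 hi (fun ε hε => unitDensity_L1_cauchy_of_uniformCauchy F hγ hC hε)
  refine ⟨ρl, hm, hl0, hil, integral_eq_one_of_tendsto _ hi hil (fun J => ?_) hlim, hlim⟩
  haveI : IsProbabilityMeasure ((fieldMeasure (F.P 0) 0 (Matrix.specialUnitaryGroup (Fin 2) ℂ)).withDensity fun u =>
      ENNReal.ofReal ((partitionFn (G := Matrix.specialUnitaryGroup (Fin 2) ℂ) (F.P J) ((F.scheme ℰp γ).β J))⁻¹ *
        unitDensity F γ J u)) := by
    rw [← unitLaw_eq_withDensity_emlDensity F J hγ]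
    exact isProbabilityMeasure_unitLaw measurableE_ℰp hγ J
  exact T4VarianceMatching.integral_density_eq_one ((unitDensity_props F J hγ).1.const_mul _) (h0 J)

/-- **UNIFORMLY CAUCHY UNIT LAWS ⇒ TOTAL-VARIATION LIMIT LAW `ρ_∞ dV_{T₁}`** (`SU(2)`, `ℰp`, `γ ≥ 0`): an absolutely continuous
probability law with `|∫ g d(unitLaw J) − ∫ g ρ_∞ dV_{T₁}| ≤ ε` for all measurable `|g| ≤ 1` simultaneously, `J ≥ J₀(ε)`. -/
theorem exists_limitUnitLaw_TV_of_uniformCauchy {γ : ℝ} (hγ : 0 ≤ γ)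
    (hC : ∀ ε : ℝ, 0 < ε → ∃ J₀ : ℕ, ∀ J J' : ℕ, J₀ ≤ J → J₀ ≤ J' →
      ∀ g : GaugeField (F.P 0) 0 (Matrix.specialUnitaryGroup (Fin 2) ℂ) → ℝ, Measurable g → (∀ u, |g u| ≤ 1) →
        |(∫ u, g u ∂F.unitLaw ℰp measurableE_ℰp γ J) - ∫ u, g u ∂F.unitLaw ℰp measurableE_ℰp γ J'| ≤ ε) :
    ∃ ρl : GaugeField (F.P 0) 0 (Matrix.specialUnitaryGroup (Fin 2) ℂ) → ℝ, Measurable ρl ∧ (∀ u, 0 ≤ ρl u) ∧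
      Integrable ρl (fieldMeasure (F.P 0) 0 (Matrix.specialUnitaryGroup (Fin 2) ℂ)) ∧
      IsProbabilityMeasure ((fieldMeasure (F.P 0) 0 (Matrix.specialUnitaryGroup (Fin 2) ℂ)).withDensity
        fun u => ENNReal.ofReal (ρl u)) ∧
      ∀ ε : ℝ, 0 < ε → ∃ J₀ : ℕ, ∀ J : ℕ, J₀ ≤ J →
        ∀ g : GaugeField (F.P 0) 0 (Matrix.specialUnitaryGroup (Fin 2) ℂ) → ℝ, Measurable g → (∀ u, |g u| ≤ 1) →
          |(∫ u, g u ∂F.unitLaw ℰp measurableE_ℰp γ J) -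
              ∫ u, g u ∂(fieldMeasure (F.P 0) 0 (Matrix.specialUnitaryGroup (Fin 2) ℂ)).withDensity
                fun u => ENNReal.ofReal (ρl u)| ≤ ε := by
  obtain ⟨ρl, hm, hl0, hil, h1, hlim⟩ := exists_limitUnitDensity_of_uniformCauchy F hγ hC
  refine ⟨ρl, hm, hl0, hil, isProbabilityMeasure_withDensity_of_integral_eq_one _ hl0 hil h1, fun ε hε => ?_⟩
  obtain ⟨J₀, hJ₀⟩ := Metric.tendsto_atTop.mp hlim ε hε
  refine ⟨J₀, fun J hJ g hgm hg1 => ?_⟩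
  have hZ : 0 < partitionFn (G := Matrix.specialUnitaryGroup (Fin 2) ℂ) (F.P J) ((F.scheme ℰp γ).β J) :=
    partitionFn_pos' _ (F.scheme_β_nonneg ℰp hγ J)
  obtain ⟨hdm, hd0, hdi⟩ := unitDensity_props F J hγ
  have h := hJ₀ J hJ
  rw [Real.dist_eq, sub_zero, abs_of_nonneg (integral_nonneg fun u => abs_nonneg _)] at h
  rw [unitLaw_eq_withDensity_emlDensity F J hγ]
  exact (abs_integral_withDensity_sub_le _ (hdm.const_mul _) hm (fun u => mul_nonneg (inv_nonneg.mpr hZ.le) (hd0 u)) hl0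
    (hdi.const_mul _) hil hgm hg1).trans h.le

/-- **K1 ∧ K2 BODIES (ANY FREE TOP FRACTION `1/m`, ANY REFINEMENT DEPTH `n`) ⇒ THE EFFECTIVE DENSITIES CONVERGE IN
`L¹(dV_{T₁})` AND THE UNIT LAWS CONVERGE IN TOTAL VARIATION** (`SU(2)`, `ℰp`, `γ ≥ 0`): route `UnitScaleTilt`'s quantifier shape
(`UnitTiltAt (F.refine n) … m ∧ HistoryTailAt (F.refine n) … m`, cf. the tree's `continuumYM3Torus_of_unitTiltAt_historyTailAt`,
which concludes the expectations only).  Neither K1 nor K2 is proved here. -/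
theorem exists_limitUnitLaw_TV_of_unitTiltAt_historyTailAt {γ : ℝ} (hγ : 0 ≤ γ) (n : ℕ) {b₀ p₀ : ℝ} {m : ℕ}
    (h1 : UnitTiltAt (F.refine n) (γ * ((F.L : ℝ)⁻¹) ^ n) b₀ p₀ m)
    (h2 : HistoryTailAt (F.refine n) (γ * ((F.L : ℝ)⁻¹) ^ n) b₀ p₀ m) :
    ∃ ρl : GaugeField (F.P 0) 0 (Matrix.specialUnitaryGroup (Fin 2) ℂ) → ℝ, Measurable ρl ∧ (∀ u, 0 ≤ ρl u) ∧
      Integrable ρl (fieldMeasure (F.P 0) 0 (Matrix.specialUnitaryGroup (Fin 2) ℂ)) ∧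
      IsProbabilityMeasure ((fieldMeasure (F.P 0) 0 (Matrix.specialUnitaryGroup (Fin 2) ℂ)).withDensity
        fun u => ENNReal.ofReal (ρl u)) ∧
      Tendsto (fun J => ∫ u, |(partitionFn (G := Matrix.specialUnitaryGroup (Fin 2) ℂ) (F.P J)
          ((F.scheme ℰp γ).β J))⁻¹ * unitDensity F γ J u - ρl u|
        ∂fieldMeasure (F.P 0) 0 (Matrix.specialUnitaryGroup (Fin 2) ℂ)) atTop (𝓝 0) ∧
      ∀ ε : ℝ, 0 < ε → ∃ J₀ : ℕ, ∀ J : ℕ, J₀ ≤ J →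
        ∀ g : GaugeField (F.P 0) 0 (Matrix.specialUnitaryGroup (Fin 2) ℂ) → ℝ, Measurable g → (∀ u, |g u| ≤ 1) →
          |(∫ u, g u ∂F.unitLaw ℰp measurableE_ℰp γ J) -
              ∫ u, g u ∂(fieldMeasure (F.P 0) 0 (Matrix.specialUnitaryGroup (Fin 2) ℂ)).withDensity
                fun u => ENNReal.ofReal (ρl u)| ≤ ε := by
  obtain ⟨r, w, hr, hw, h⟩ := unitTiltTail_of_unitTiltAt_historyTailAt h1 h2
  have hC := fun ε (hε : 0 < ε) =>
    unitLaw_uniformCauchy_of_refine_unitTiltTail F ℰp measurableE_ℰp n hγ hr hw hw h hε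
  obtain ⟨ρl, hm, hl0, hil, h1', hlim⟩ := exists_limitUnitDensity_of_uniformCauchy F hγ hC
  refine ⟨ρl, hm, hl0, hil, isProbabilityMeasure_withDensity_of_integral_eq_one _ hl0 hil h1', hlim, fun ε hε => ?_⟩
  obtain ⟨J₀, hJ₀⟩ := Metric.tendsto_atTop.mp hlim ε hε
  refine ⟨J₀, fun J hJ g hgm hg1 => ?_⟩
  have hZ : 0 < partitionFn (G := Matrix.specialUnitaryGroup (Fin 2) ℂ) (F.P J) ((F.scheme ℰp γ).β J) :=
    partitionFn_pos' _ (F.scheme_β_nonneg ℰp hγ J)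
  obtain ⟨hdm, hd0, hdi⟩ := unitDensity_props F J hγ
  have h := hJ₀ J hJ
  rw [Real.dist_eq, sub_zero, abs_of_nonneg (integral_nonneg fun u => abs_nonneg _)] at h
  rw [unitLaw_eq_withDensity_emlDensity F J hγ]
  exact (abs_integral_withDensity_sub_le _ (hdm.const_mul _) hm (fun u => mul_nonneg (inv_nonneg.mpr hZ.le) (hd0 u)) hl0
    (hdi.const_mul _) hil hgm hg1).trans h.le

end UnitLaw

end Summit.QuantumFields.YangMills.Theorems.WideningTVTail

end
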